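import Summits.BirchSwinnertonDyer.Rank1Residual.Additive.RationalLineTwistRamifiedOfKernelPolynomial
import Summits.BirchSwinnertonDyer.Rank1Residual.Additive.RationalLineParityOfKernelPolynomial
import Summits.BirchSwinnertonDyer.Rank1Residual.Additive.X3BranchGordEndStateRamifiedLine
import Summits.BirchSwinnertonDyer.Rank1Residual.Additive.X3LineDatumFiveRecordsPrototype
import Summits.BirchSwinnertonDyer.Rank1Residual.Additive.X3LineDatumSevenRecordsPrototype
import HarnessLib

/-!
# The Case-1 LINE DATUM `CaseOneDatum W p` at `p ≥ 5` from a finite KERNEL-POLYNOMIAL CERTIFICATE —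
# assembly of the keystone (rational line), the trace certificate (even) and the valuation
# certificate (`χ_{p*}`-twist ramified); per-prime wrappers at `p = 5, 7, 13`
# (cell `bsd-addord`, seat `bsd-addord-twist`; the Φ₀ kernel-records programme)

HONEST FRAMING (cell `bsd-addord`, `run/shared/lean/pub/bsd-addord/README.md` §4): the programme's
target of record is the full Birch–Swinnerton-Dyer formula for every `E/ℚ` of analytic rank `≤ 1`;
this is a TOOL file (theorems only, no definition, no named fact, no `sorry`). It books nothing: the
class binders `ClassX3Gord W p`, `semistabilityIndex W p = 2` and global minimality of the member stay
data of record exactly as in the booking doors (`X3BranchGordEndStateRamifiedLine.lean`).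

## What

**`ClassX3Gord.caseOneDatum_of_kernelPolyCert`**: on an X3♯(G-ord) ∩ `I₀*` model `W` at `p ≥ 5`
(`2m + 1 = p`), a MONIC `h ∈ ℤ[X]` of degree `m` with
* (c1) `W.preΨ' p = h · q`, (c2) `∑_{i ≤ m} h_i Φ₂^i Ψ₂Sq^{m−i} = h · q₂`, (c3) `±2` generates `𝔽_pˣ`
  (⟹ a rational `p`-line `Φ₀` above the roots of `h`, `exists_isRationalLine_of_kernelPolyCert`),
* (B) the trace certificate `T(h) = 4p₃ + b₂p₂ + 2b₄p₁ + m·b₆ > 0` (⟹ `Φ₀` even,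
  `lineEven_of_traceCert_pos`),
* (C) the valuation certificate `p^{m−k} ∣ c_k` (`0 < k < m`), `c₀ = p^{m−1} a`, `p ∤ a`
  (⟹ the `χ_{p*}`-twist of `Φ₀` is ramified at `p`, `ClassX3Gord.hram_of_kernelPolyCert`),
yields `CaseOneDatum W p` (`hram0` by `ClassX3Gord.not_lineUnramifiedAt`, via
`caseOneDatum_of_isRationalLine_of_lineEven`). Per-prime wrappers with the kernel polynomial given by
its integer coefficients — **`caseOneDatum_five_of_cert`** (`h = X² + c₁X + c₀`),
**`caseOneDatum_seven_of_cert`** (`h = X³ + c₂X² + c₁X + c₀`), **`caseOneDatum_thirteen_of_cert`**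
(degree `6`) — reduce a row of `HOME/proof/phi0-p5/MANIFEST.tsv` to two polynomial identities
(`funext` + `ring`), one rational inequality and a few integer divisibilities (`norm_num`/`decide`):
the records files `X3LineDatum{Five,Seven,Thirteen}Records*.lean`.

References: R. Greenberg, V. Vatsal, Invent. Math. 142 (2000) §2 p. 28 [GreenbergVatsal2000];
J. H. Silverman, *AEC* 2nd ed., Exercise 3.7, III.2.3, VII.2.1 [SilvermanAEC2009];
HOME/proof/phi0-p5/README.md (the engines' dictionary, now kernel theorems column by column).
-/

set_option autoImplicit false

noncomputable section

open scoped Classical NumberField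

open WeierstrassCurve Polynomial Literature.NumberTheory.EllipticCurves
  Literature.NumberTheory.EllipticCurves.Rank1Residual Literature.NumberTheory.GaloisRepresentations
  Field IsDedekindDomain NumberField
  Summit.BirchSwinnertonDyer.Rank1Residual.Additive.KernelPolyLineRecords

namespace Summit.BirchSwinnertonDyer.Rank1Residual.Additive.KernelPolyLine

variable {W : WeierstrassCurve ℚ} [W.IsElliptic] [W.IsGloballyMinimal] {p : ℕ} [hp : Fact p.Prime]

/-- **`CaseOneDatum` at `p ≥ 5` from a kernel-polynomial certificate** (keystone + trace certificate +
valuation certificate; see the module docstring). [cite: GreenbergVatsal2000, §2 p. 28]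
[cite: SilvermanAEC2009, Exercise 3.7] -/
theorem ClassX3Gord.caseOneDatum_of_kernelPolyCert (hX : ClassX3Gord W p) (hp5 : 5 ≤ p)
    (he : semistabilityIndex W p = 2) {h q q₂ : ℚ[X]} {m : ℕ} (hm : 2 * m + 1 = p)
    (hmon : h.Monic) (hdegm : h.natDegree = m) (hdiv : W.preΨ' p = h * q)
    (hdbl : ∑ i ∈ Finset.range (m + 1), C (h.coeff i) * W.Φ 2 ^ i * W.Ψ₂Sq ^ (m - i) = h * q₂)
    (hgen : ∀ k : ZMod p, k ≠ 0 → ∃ (s : ℤˣ) (j : ℕ), k = ((s : ℤ) * 2 ^ j : ℤ))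
    {E₁ E₂ E₃ : ℚ} (hE₁ : h.coeff (m - 1) = -E₁) (hE₂ : h.coeff (m - 2) = E₂)
    (hE₃ : (3 ≤ m ∧ h.coeff (m - 3) = -E₃) ∨ (m = 2 ∧ E₃ = 0))
    (hT : 0 < 4 * (E₁ ^ 3 - 3 * E₁ * E₂ + 3 * E₃) + W.b₂ * (E₁ ^ 2 - 2 * E₂) + 2 * W.b₄ * E₁ + m * W.b₆)
    (hcoef : ∀ k, 0 < k → k < m → ∃ c : ℤ, h.coeff k = (c : ℚ) ∧ (p : ℤ) ^ (m - k) ∣ c)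
    (hzero : ∃ a : ℤ, h.coeff 0 = (p : ℚ) ^ (m - 1) * a ∧ ¬ (p : ℤ) ∣ a) :
    CaseOneDatum W p := by
  have hp2 : p ≠ 2 := by omega
  have hm2 : 2 ≤ m := by omega
  -- a root of `h` in `ℚ̄`
  have hne : h ≠ 0 := hmon.ne_zero
  have hd : (h.map (algebraMap ℚ (AlgebraicClosure ℚ))).degree ≠ 0 := by
    rw [degree_map, degree_eq_natDegree hne, hdegm]
    exact_mod_cast (show m ≠ 0 by omega)
  obtain ⟨α, hα⟩ := IsAlgClosed.exists_root _ hd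
  obtain ⟨Φ₀, hΦ, habs⟩ := exists_isRationalLine_of_kernelPolyCert hp2 hm hdegm.le hdiv hdbl hgen ⟨α, hα⟩
  have heven : LineEven W p Φ₀ :=
    lineEven_of_traceCert_pos hp2 hm hmon hdegm hdiv hΦ habs hE₁ hE₂ hE₃ hT
  have hram := ClassX3Gord.hram_of_kernelPolyCert hX hp5 he hm hmon hdegm hcoef hzero hΦ habs
  exact caseOneDatum_of_isRationalLine_of_lineEven hX hp5 he Φ₀ hΦ heven hram

omit [W.IsElliptic] [W.IsGloballyMinimal] in
/-- The components of a Case-1 datum at `p ≥ 5` (the `p = 3` disjunct is void). [folklore] -/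
theorem exists_of_caseOneDatum (hp5 : 5 ≤ p) (hD : CaseOneDatum W p) :
    ∃ Φ₀ : AddSubgroup (W.geomTorsion (p : ℤ)), IsRationalLine W p Φ₀ ∧
      ¬ LineUnramifiedAt W p Φ₀ ∧ LineEven W p Φ₀ ∧
      ∀ (K : Type) [Field K] [NumberField K] [(galRange (K := ℚ) K).Normal],
        Module.finrank ℚ K = 2 → (∃ θ : K, θ ^ 2 = algebraMap ℚ K ((-1) ^ (p / 2) * p)) →
        ¬ ∀ v : HeightOneSpectrum (𝓞 ℚ), ((p : ℕ) : 𝓞 ℚ) ∈ v.asIdeal →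
          ∀ 𝔓 ∈ v.primesAbove, ∀ σ ∈ 𝔓.inertia (Field.absoluteGaloisGroup ℚ), ∀ P ∈ Φ₀,
            σ • P = (if σ ∈ galRange (K := ℚ) K then P else -P) := by
  rcases hD with ⟨h3, -⟩ | ⟨-, hrest⟩
  · omega
  · exact hrest

/-! ## The univariate division polynomials `preΨ'₅`, `preΨ'₇` in closed form (any curve) -/

omit [W.IsElliptic] [W.IsGloballyMinimal] hp in
/-- `preΨ'₅ = preΨ₄ · Ψ₂Sq² − Ψ₃³` (Mathlib's recursion `preΨ'_odd` at `m = 0`). [folklore] -/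
theorem preΨ'_five_eq {R : Type*} [CommRing R] (V : WeierstrassCurve R) :
    V.preΨ' 5 = V.preΨ₄ * V.Ψ₂Sq ^ 2 - V.Ψ₃ ^ 3 := by
  rw [show (5 : ℕ) = 2 * (0 + 2) + 1 from rfl, preΨ'_odd]
  rw [if_pos (by decide : Even (0 : ℕ)), if_pos (by decide : Even (0 : ℕ))]
  simp only [zero_add, preΨ'_four, preΨ'_two, preΨ'_one, preΨ'_three, one_pow, mul_one, one_mul]

omit [W.IsElliptic] [W.IsGloballyMinimal] hp in
/-- `preΨ'₇ = preΨ'₅ · Ψ₃³ − preΨ₄³ · Ψ₂Sq²` (Mathlib's recursion `preΨ'_odd` at `m = 1`). [folklore] -/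
theorem preΨ'_seven_eq {R : Type*} [CommRing R] (V : WeierstrassCurve R) :
    V.preΨ' 7 = (V.preΨ₄ * V.Ψ₂Sq ^ 2 - V.Ψ₃ ^ 3) * V.Ψ₃ ^ 3 - V.preΨ₄ ^ 3 * V.Ψ₂Sq ^ 2 := by
  rw [show (7 : ℕ) = 2 * (1 + 2) + 1 from rfl, preΨ'_odd]
  rw [if_neg (by decide : ¬ Even (1 : ℕ)), if_neg (by decide : ¬ Even (1 : ℕ))]
  simp only [show 1 + 4 = 5 from rfl, show 1 + 2 = 3 from rfl, show 1 + 1 = 2 from rfl,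
    show 1 + 3 = 4 from rfl, preΨ'_five_eq, preΨ'_four, preΨ'_two, preΨ'_three, mul_one, one_mul]

/-! ## Per-prime wrappers: the kernel polynomial by its integer coefficients -/

/-- **`p = 5`** (`m = 2`, `h = X² + c₁X + c₀`): `CaseOneDatum W 5` from (c1) `preΨ'₅ = h·q`,
(c2) `c₀Ψ₂Sq² + c₁Φ₂Ψ₂Sq + Φ₂² = h·q₂`, the trace inequality
`T = 4(−c₁³ + 3c₁c₀) + b₂(c₁² − 2c₀) − 2b₄c₁ + 2b₆ > 0`, and `5 ∣ c₁`, `c₀ = 5a`, `5 ∤ a`.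
[cite: GreenbergVatsal2000, §2 p. 28] -/
theorem caseOneDatum_five_of_cert [Fact (Nat.Prime 5)] (hX : ClassX3Gord W 5)
    (he : semistabilityIndex W 5 = 2) (c₁ c₀ a : ℤ) (q q₂ : ℚ[X])
    (hdiv : W.preΨ' 5 = (X ^ 2 + C (c₁ : ℚ) * X + C (c₀ : ℚ)) * q)
    (hdbl : C (c₀ : ℚ) * W.Ψ₂Sq ^ 2 + C (c₁ : ℚ) * W.Φ 2 * W.Ψ₂Sq + W.Φ 2 ^ 2 =
      (X ^ 2 + C (c₁ : ℚ) * X + C (c₀ : ℚ)) * q₂)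
    (hT : 0 < 4 * ((-(c₁ : ℚ)) ^ 3 - 3 * (-(c₁ : ℚ)) * c₀ + 3 * 0) + W.b₂ * ((-(c₁ : ℚ)) ^ 2 - 2 * c₀) +
      2 * W.b₄ * (-(c₁ : ℚ)) + (2 : ℕ) * W.b₆)
    (hc₁ : (5 : ℤ) ∣ c₁) (hc₀ : c₀ = 5 * a) (ha : ¬ (5 : ℤ) ∣ a) : CaseOneDatum W 5 := by
  set h : ℚ[X] := X ^ 2 + C (c₁ : ℚ) * X + C (c₀ : ℚ) with hh
  have hmon : h.Monic := by rw [hh]; monicity!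
  have hdegm : h.natDegree = 2 := by rw [hh]; compute_degree!
  have hc0 : h.coeff 0 = c₀ := by
    rw [hh]; simp only [coeff_add, coeff_C_mul, coeff_X_pow, coeff_X, coeff_C]; norm_num
  have hc1 : h.coeff 1 = c₁ := by
    rw [hh]; simp only [coeff_add, coeff_C_mul, coeff_X_pow, coeff_X, coeff_C]; norm_num
  have hc2 : h.coeff 2 = 1 := by
    rw [hh]; simp only [coeff_add, coeff_C_mul, coeff_X_pow, coeff_X, coeff_C]; norm_num
  refine ClassX3Gord.caseOneDatum_of_kernelPolyCert hX (le_refl 5) he (m := 2) rfl hmon hdegm hdiv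
    (q₂ := q₂) ?_ gen_five (E₁ := -(c₁ : ℚ)) (E₂ := (c₀ : ℚ)) (E₃ := 0) (by rw [hc1, neg_neg])
    (by rw [hc0]) (Or.inr ⟨rfl, rfl⟩) hT ?_ ?_
  · simp only [Finset.sum_range_succ, Finset.sum_range_zero, zero_add, hc0, hc1, hc2, pow_zero, pow_one,
      Nat.sub_zero, Nat.sub_self, show 2 - 1 = 1 from rfl, mul_one, one_mul, map_one]
    rw [← hdbl]
  · intro k hk0 hk2
    obtain rfl : k = 1 := by omega
    exact ⟨c₁, hc1, by rw [pow_one]; exact hc₁⟩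
  · exact ⟨a, by rw [hc0, hc₀]; push_cast; ring, ha⟩

/-- **`p = 7`** (`m = 3`, `h = X³ + c₂X² + c₁X + c₀`): `CaseOneDatum W 7` from (c1), (c2), the trace
inequality with `E₁ = −c₂`, `E₂ = c₁`, `E₃ = −c₀`, and `7 ∣ c₂`, `7² ∣ c₁`, `c₀ = 7²a`, `7 ∤ a`.
[cite: GreenbergVatsal2000, §2 p. 28] -/
theorem caseOneDatum_seven_of_cert [Fact (Nat.Prime 7)] (hX : ClassX3Gord W 7)
    (he : semistabilityIndex W 7 = 2) (c₂ c₁ c₀ a : ℤ) (q q₂ : ℚ[X])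
    (hdiv : W.preΨ' 7 = (X ^ 3 + C (c₂ : ℚ) * X ^ 2 + C (c₁ : ℚ) * X + C (c₀ : ℚ)) * q)
    (hdbl : C (c₀ : ℚ) * W.Ψ₂Sq ^ 3 + C (c₁ : ℚ) * W.Φ 2 * W.Ψ₂Sq ^ 2 + C (c₂ : ℚ) * W.Φ 2 ^ 2 * W.Ψ₂Sq +
      W.Φ 2 ^ 3 = (X ^ 3 + C (c₂ : ℚ) * X ^ 2 + C (c₁ : ℚ) * X + C (c₀ : ℚ)) * q₂)
    (hT : 0 < 4 * ((-(c₂ : ℚ)) ^ 3 - 3 * (-(c₂ : ℚ)) * c₁ + 3 * (-(c₀ : ℚ))) +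
      W.b₂ * ((-(c₂ : ℚ)) ^ 2 - 2 * c₁) + 2 * W.b₄ * (-(c₂ : ℚ)) + (3 : ℕ) * W.b₆)
    (hc₂ : (7 : ℤ) ∣ c₂) (hc₁ : (7 : ℤ) ^ 2 ∣ c₁) (hc₀ : c₀ = 7 ^ 2 * a) (ha : ¬ (7 : ℤ) ∣ a) :
    CaseOneDatum W 7 := by
  set h : ℚ[X] := X ^ 3 + C (c₂ : ℚ) * X ^ 2 + C (c₁ : ℚ) * X + C (c₀ : ℚ) with hh
  have hmon : h.Monic := by rw [hh]; monicity!
  have hdegm : h.natDegree = 3 := by rw [hh]; compute_degree!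
  have hc0 : h.coeff 0 = c₀ := by
    rw [hh]; simp only [coeff_add, coeff_C_mul, coeff_X_pow, coeff_X, coeff_C]; norm_num
  have hc1 : h.coeff 1 = c₁ := by
    rw [hh]; simp only [coeff_add, coeff_C_mul, coeff_X_pow, coeff_X, coeff_C]; norm_num
  have hc2 : h.coeff 2 = c₂ := by
    rw [hh]; simp only [coeff_add, coeff_C_mul, coeff_X_pow, coeff_X, coeff_C]; norm_num
  have hc3 : h.coeff 3 = 1 := by
    rw [hh]; simp only [coeff_add, coeff_C_mul, coeff_X_pow, coeff_X, coeff_C]; norm_num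
  refine ClassX3Gord.caseOneDatum_of_kernelPolyCert hX (by norm_num) he (m := 3) rfl hmon hdegm hdiv
    (q₂ := q₂) ?_ gen_seven (E₁ := -(c₂ : ℚ)) (E₂ := (c₁ : ℚ)) (E₃ := -(c₀ : ℚ)) (by rw [hc2, neg_neg])
    (by rw [hc1]) (Or.inl ⟨le_refl 3, by rw [hc0, neg_neg]⟩) hT ?_ ?_
  · simp only [Finset.sum_range_succ, Finset.sum_range_zero, zero_add, hc0, hc1, hc2, hc3, pow_zero,
      pow_one, Nat.sub_zero, Nat.sub_self, show 3 - 1 = 2 from rfl, show 3 - 2 = 1 from rfl, mul_one,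
      one_mul, map_one]
    rw [← hdbl]
  · intro k hk0 hk3
    interval_cases k
    · exact ⟨c₁, hc1, hc₁⟩
    · exact ⟨c₂, hc2, by rw [pow_one]; exact hc₂⟩
  · exact ⟨a, by rw [hc0, hc₀]; push_cast; ring, ha⟩

/-- (c3) at `p = 13`: every non-zero residue is `± 2^j` (`2` is a primitive root mod `13`).
[folklore] -/
theorem gen_thirteen : ∀ k : ZMod 13, k ≠ 0 → ∃ (s : ℤˣ) (j : ℕ), k = ((s : ℤ) * 2 ^ j : ℤ) := by
  intro k hk
  have hv : k.val < 13 := k.val_lt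
  have hk' : k = (k.val : ZMod 13) := (ZMod.natCast_zmod_val k).symm
  interval_cases h : k.val
  · exact absurd (by rw [hk']; rfl) hk
  · exact ⟨1, 0, by rw [hk']; rfl⟩
  · exact ⟨1, 1, by rw [hk']; rfl⟩
  · exact ⟨1, 4, by rw [hk']; rfl⟩
  · exact ⟨1, 2, by rw [hk']; rfl⟩
  · exact ⟨1, 9, by rw [hk']; rfl⟩
  · exact ⟨1, 5, by rw [hk']; rfl⟩
  · exact ⟨1, 11, by rw [hk']; rfl⟩
  · exact ⟨1, 3, by rw [hk']; rfl⟩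
  · exact ⟨1, 8, by rw [hk']; rfl⟩
  · exact ⟨1, 10, by rw [hk']; rfl⟩
  · exact ⟨1, 7, by rw [hk']; rfl⟩
  · exact ⟨1, 6, by rw [hk']; rfl⟩

/-- **`p = 13`** (`m = 6`, `h = X⁶ + c₅X⁵ + ⋯ + c₀`): `CaseOneDatum W 13` from (c1), (c2), the trace
inequality with `E₁ = −c₅`, `E₂ = c₄`, `E₃ = −c₃`, and `13^{6−k} ∣ c_k` (`0 < k < 6`), `c₀ = 13⁵a`,
`13 ∤ a`. [cite: GreenbergVatsal2000, §2 p. 28] -/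
theorem caseOneDatum_thirteen_of_cert [Fact (Nat.Prime 13)] (hX : ClassX3Gord W 13)
    (he : semistabilityIndex W 13 = 2) (c₅ c₄ c₃ c₂ c₁ c₀ a : ℤ) (q q₂ : ℚ[X])
    (hdiv : W.preΨ' 13 = (X ^ 6 + C (c₅ : ℚ) * X ^ 5 + C (c₄ : ℚ) * X ^ 4 + C (c₃ : ℚ) * X ^ 3 +
      C (c₂ : ℚ) * X ^ 2 + C (c₁ : ℚ) * X + C (c₀ : ℚ)) * q)
    (hdbl : C (c₀ : ℚ) * W.Ψ₂Sq ^ 6 + C (c₁ : ℚ) * W.Φ 2 * W.Ψ₂Sq ^ 5 + C (c₂ : ℚ) * W.Φ 2 ^ 2 * W.Ψ₂Sq ^ 4 +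
      C (c₃ : ℚ) * W.Φ 2 ^ 3 * W.Ψ₂Sq ^ 3 + C (c₄ : ℚ) * W.Φ 2 ^ 4 * W.Ψ₂Sq ^ 2 +
      C (c₅ : ℚ) * W.Φ 2 ^ 5 * W.Ψ₂Sq + W.Φ 2 ^ 6 =
      (X ^ 6 + C (c₅ : ℚ) * X ^ 5 + C (c₄ : ℚ) * X ^ 4 + C (c₃ : ℚ) * X ^ 3 + C (c₂ : ℚ) * X ^ 2 +
        C (c₁ : ℚ) * X + C (c₀ : ℚ)) * q₂)
    (hT : 0 < 4 * ((-(c₅ : ℚ)) ^ 3 - 3 * (-(c₅ : ℚ)) * c₄ + 3 * (-(c₃ : ℚ))) +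
      W.b₂ * ((-(c₅ : ℚ)) ^ 2 - 2 * c₄) + 2 * W.b₄ * (-(c₅ : ℚ)) + (6 : ℕ) * W.b₆)
    (hc₅ : (13 : ℤ) ∣ c₅) (hc₄ : (13 : ℤ) ^ 2 ∣ c₄) (hc₃ : (13 : ℤ) ^ 3 ∣ c₃) (hc₂ : (13 : ℤ) ^ 4 ∣ c₂)
    (hc₁ : (13 : ℤ) ^ 5 ∣ c₁) (hc₀ : c₀ = 13 ^ 5 * a) (ha : ¬ (13 : ℤ) ∣ a) :
    CaseOneDatum W 13 := by
  set h : ℚ[X] := X ^ 6 + C (c₅ : ℚ) * X ^ 5 + C (c₄ : ℚ) * X ^ 4 + C (c₃ : ℚ) * X ^ 3 +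
      C (c₂ : ℚ) * X ^ 2 + C (c₁ : ℚ) * X + C (c₀ : ℚ) with hh
  have hc0 : h.coeff 0 = c₀ := by
    rw [hh]; simp only [coeff_add, coeff_C_mul, coeff_X_pow, coeff_X, coeff_C]; norm_num
  have hc1 : h.coeff 1 = c₁ := by
    rw [hh]; simp only [coeff_add, coeff_C_mul, coeff_X_pow, coeff_X, coeff_C]; norm_num
  have hc2 : h.coeff 2 = c₂ := by
    rw [hh]; simp only [coeff_add, coeff_C_mul, coeff_X_pow, coeff_X, coeff_C]; norm_num
  have hc3 : h.coeff 3 = c₃ := by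
    rw [hh]; simp only [coeff_add, coeff_C_mul, coeff_X_pow, coeff_X, coeff_C]; norm_num
  have hc4 : h.coeff 4 = c₄ := by
    rw [hh]; simp only [coeff_add, coeff_C_mul, coeff_X_pow, coeff_X, coeff_C]; norm_num
  have hc5 : h.coeff 5 = c₅ := by
    rw [hh]; simp only [coeff_add, coeff_C_mul, coeff_X_pow, coeff_X, coeff_C]; norm_num
  have hc6 : h.coeff 6 = 1 := by
    rw [hh]; simp only [coeff_add, coeff_C_mul, coeff_X_pow, coeff_X, coeff_C]; norm_num
  have hmon : h.Monic := by rw [hh]; monicity!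
  have hdegm : h.natDegree = 6 := by rw [hh]; compute_degree!
  refine ClassX3Gord.caseOneDatum_of_kernelPolyCert hX (by norm_num) he (m := 6) rfl hmon hdegm hdiv
    (q₂ := q₂) ?_ gen_thirteen (E₁ := -(c₅ : ℚ)) (E₂ := (c₄ : ℚ)) (E₃ := -(c₃ : ℚ)) (by rw [hc5, neg_neg])
    (by rw [hc4]) (Or.inl ⟨by norm_num, by rw [hc3, neg_neg]⟩) hT ?_ ?_
  · simp only [Finset.sum_range_succ, Finset.sum_range_zero, zero_add, hc0, hc1, hc2, hc3, hc4, hc5,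
      hc6, pow_zero, pow_one, Nat.sub_zero, Nat.sub_self, show 6 - 1 = 5 from rfl,
      show 6 - 2 = 4 from rfl, show 6 - 3 = 3 from rfl, show 6 - 4 = 2 from rfl, show 6 - 5 = 1 from rfl,
      mul_one, one_mul, map_one]
    rw [← hdbl]
  · intro k hk0 hk6
    interval_cases k
    · exact ⟨c₁, hc1, hc₁⟩
    · exact ⟨c₂, hc2, hc₂⟩
    · exact ⟨c₃, hc3, hc₃⟩
    · exact ⟨c₄, hc4, hc₄⟩
    · exact ⟨c₅, hc5, by rw [pow_one]; exact hc₅⟩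
  · exact ⟨a, by rw [hc0, hc₀]; push_cast; ring, ha⟩

end Summit.BirchSwinnertonDyer.Rank1Residual.Additive.KernelPolyLine

end
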